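import Summits.QuantumFields.YangMills.Theorems.BalabanLadderNTMirrorHankelInward
import Summits.QuantumFields.YangMills.Theorems.BalabanLadderNTMirrorHankelQ2Floor
import HarnessLib

/-!
# Crux `NT` (stmt-QuantumFields-19353): clause (i) on all large tori gives the (MF) floor at EVERY smaller offset

Helper file (`--supports stmt-QuantumFields-19353`) of the fleet lead prover of crux `NT` (unit `ym-spine-19353-p1`,
g11), hypothesis-free; the inward-propagation theorem `mirrorFloor_cubeSmear_inward` (`…NTMirrorHankelInward`) read in
the crux's OWN letters through g10's `mirrorFloor_of_Q2_floor` (`ε ≤ Q2 G r β L s (θv) v` ⇒ `ε² ≤ K_R² · (MF)` of the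
witness cube):

* **`q2Floor_inward`** — at one coupling `β ≥ 0` and spacing `s`: if the lattice support of `v(s·)` sits in a cube `(c, b)`
  at depth `≥ 2` with `0 ≤ c 0` (offset `c 0` from the reflection plane), if `ε ≤ Q2 G r β L s (θv) v` on EVERY torus
  `L ≥ L₀` (`ε > 0`; cube inside the box, `c 0 + b + 1 ≤ L₀`), `K_R > 0` bounds the reflected-species smearing and `K₀ > 0`
  the base smearing `Ṽ₀` (the witness cube moved down to the mirror), then for every `θ ∈ (0,1)` there is `L₁` such that on
  all tori `L ≥ L₁` the seam's (MF) form of the witness cube moved to ANY offset `s′ ≤ c 0` is at least `θ · ε²/K_R²`: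
  `θ · ε²/K_R² ≤ mirrorForm G r β L Ṽ_{s′} Ṽ_{s′}`.

Reading (owner's / LEAD's pen, nothing registered): a clause-(i) witness at physical offset `δ` supplies, on large tori,
the seam's (MF) currency at every offset `≤ δ` with the SAME size `ε²/K_R²` up to a factor `θ` of one's choosing — the
residual (MF) floor of `stub_floorsEngine` may be placed anywhere between the mirror and the NT witness.

Refs: J. Glimm, A. Jaffe, *Quantum Physics* (1987) §6.1; K. Osterwalder, E. Seiler, Ann. Phys. 110 (1978) §2;
J. Fröhlich, R. Israel, E. Lieb, B. Simon, CMP 62 (1978) Thm 2.1 (RPCS).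
-/

set_option autoImplicit false

noncomputable section

open scoped SchwartzMap
open MeasureTheory Finset
open Literature.MathematicalPhysics.QuantumFieldTheory Literature.MathematicalPhysics.QuantumLattice
open Literature.Probability.LatticeModels
open Summit.QuantumFields.YangMills.Cruxes.OSLegsFromFemtoAndGap.DlrCollarTransfer
open Summit.QuantumFields.YangMills.Cruxes.NT.CumulantPolarisation
open Summit.QuantumFields.YangMills.Cruxes.NT.MarkovMirror (exists_isCylinder_cubeSmear)

namespace Summit.QuantumFields.YangMills.Cruxes.NT.MirrorHankel

variable {G : Type} [Group G] [TopologicalSpace G] [IsTopologicalGroup G] [CompactSpace G]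
  [MeasurableSpace G] [BorelSpace G] {r : LatticeRep G}

/-- **Clause (i) on all large tori ⇒ the (MF) floor `θ · ε²/K_R²` at every offset `s′ ≤ c 0`, on all larger tori.**  At one
coupling `β ≥ 0` and spacing `s`: the lattice support of `v(s·)` in a cube `(c, b)` at depth `≥ 2` with `0 ≤ c 0`; the cube in
the box and `c 0 + b + 1 ≤ L₀`; `K_R > 0` bounds `Wᴿ`; the base smearing `Ṽ₀ := cubeSmear (c − (c 0)e₀) b (v(s·(· + (c 0)e₀)))`
is bounded by `K₀ > 0`.  If `ε ≤ Q2 G r β L s (θv) v` for all `L ≥ L₀` (`ε > 0`), then for every `θ ∈ (0,1)` there is `L₁`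
with `θ · (ε²/K_R²) ≤ mirrorForm G r β L Ṽ_{s′} Ṽ_{s′}` for all `L ≥ L₁` and all `s′ ≤ (c 0).toNat`, where
`Ṽ_{s′} = cubeSmear (c − (c 0)e₀ + s′e₀) b (v(s·(· + (c 0)e₀ − s′e₀)))` is the witness cube moved to offset `s′`.
[cite: GlimmJaffe1987, §6.1] -/
theorem q2Floor_inward {β : ℝ} (hβ : 0 ≤ β) (s : ℝ) (v : 𝓢(EuclideanSpace ℝ (Fin 4), ℝ))
    (c : Fin 4 → ℤ) (b : ℕ) (hc0 : 0 ≤ c 0)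
    (hsupp : ∀ y : Fin 4 → ℤ, v (s • siteToE y) ≠ 0 → y ∈ cubeSites c b ∧ 2 ≤ depth c b y)
    {KR : ℝ} (hKRpos : 0 < KR) (hKR : ∀ V, |reflSmear G r c b (fun x => v (s • siteToE x)) V| ≤ KR)
    {K₀ : ℝ} (hK₀pos : 0 < K₀)
    (hK₀ : ∀ V, |cubeSmear G r (c - Pi.single 0 (c 0)) b
      (fun y => v (s • siteToE (y + Pi.single 0 (c 0)))) V| ≤ K₀)
    {L₀ : ℕ} (hL₀ : c 0 + b + 1 ≤ (L₀ : ℤ)) (hsub : ∀ L : ℕ, L₀ ≤ L → cubeSites c b ⊆ box 4 L)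
    {ε : ℝ} (hε : 0 < ε) (hfloor : ∀ L : ℕ, L₀ ≤ L → ε ≤ Q2 G r β L s (thetaTest 4 v) v)
    {θ : ℝ} (hθ : 0 < θ) (hθ1 : θ < 1) :
    ∃ L₁ : ℕ, ∀ L : ℕ, L₁ ≤ L → ∀ s' : ℕ, s' ≤ (c 0).toNat →
      θ * (ε ^ 2 / KR ^ 2) ≤ mirrorForm G r β L
        (cubeSmear G r (c - Pi.single 0 (c 0) + Pi.single 0 (s' : ℤ)) b
          (fun y => v (s • siteToE (y - Pi.single 0 (s' : ℤ) + Pi.single 0 (c 0)))))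
        (cubeSmear G r (c - Pi.single 0 (c 0) + Pi.single 0 (s' : ℤ)) b
          (fun y => v (s • siteToE (y - Pi.single 0 (s' : ℤ) + Pi.single 0 (c 0))))) := by
  haveI := r.secondCountableTopology
  set c₀ : Fin 4 → ℤ := c - Pi.single 0 (c 0) with hc₀
  set w₀ : (Fin 4 → ℤ) → ℝ := fun y => v (s • siteToE (y + Pi.single 0 (c 0))) with hw₀
  have hc₀0 : 0 ≤ c₀ 0 := by simp [hc₀]
  have hcast : ((c 0).toNat : ℤ) = c 0 := Int.toNat_of_nonneg hc0
  -- the translated base cube at offset `c 0` is the original cube, with the original weights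
  have hcube : c₀ + Pi.single 0 (((c 0).toNat : ℕ) : ℤ) = c := by
    rw [hcast, hc₀, sub_add_cancel]
  have hweights : (fun y => w₀ (y - Pi.single 0 (((c 0).toNat : ℕ) : ℤ))) = fun y => v (s • siteToE y) := by
    funext y; rw [hcast, hw₀]; simp only [sub_add_cancel]
  -- regularity of the base smearing
  have hWm : Measurable (cubeSmear G r c₀ b w₀) := (continuous_cubeSmear' G r c₀ b w₀).measurable
  obtain ⟨SW, hWS, hSW⟩ := exists_isCylinder_cubeSmear G r c₀ b w₀
  have hX : 0 < ε ^ 2 / KR ^ 2 := div_pos (pow_pos hε 2) (pow_pos hKRpos 2)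
  -- the (MF) floor of the cube at offset `c 0` on every torus `L ≥ L₀`, from the clause-(i) floor
  have hMF : ∀ L : ℕ, L₀ ≤ L →
      ε ^ 2 / KR ^ 2 ≤ mirrorForm G r β L
        (cubeSmear G r (c₀ + Pi.single 0 (((c 0).toNat : ℕ) : ℤ)) b
          (fun y => w₀ (y - Pi.single 0 (((c 0).toNat : ℕ) : ℤ))))
        (cubeSmear G r (c₀ + Pi.single 0 (((c 0).toNat : ℕ) : ℤ)) b
          (fun y => w₀ (y - Pi.single 0 (((c 0).toNat : ℕ) : ℤ)))) := by
    intro L hL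
    rw [hcube, hweights]
    have hL1 : 1 ≤ L := by
      have : (1 : ℤ) ≤ L₀ := by linarith [hc0]
      omega
    have h := mirrorFloor_of_Q2_floor G r hβ L hL1 s v c b hc0 (by linarith [(Int.ofNat_le.mpr hL : (L₀ : ℤ) ≤ L)])
      (hsub L hL) hsupp hKR hε.le (hfloor L hL)
    rw [div_le_iff₀ (pow_pos hKRpos 2), mul_comm]
    exact h
  obtain ⟨L₁, h⟩ := mirrorFloor_cubeSmear_inward (r := r) hβ hc₀0 hWm hK₀pos hK₀ hWS hSW hX hMF hθ hθ1
  refine ⟨L₁, fun L hL s' hs' => ?_⟩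
  have h1 := h L hL s' hs'
  have hw : (fun y : Fin 4 → ℤ => w₀ (y - Pi.single 0 (s' : ℤ))) =
      fun y : Fin 4 → ℤ => v (s • siteToE (y - Pi.single 0 (s' : ℤ) + Pi.single 0 (c 0))) := by
    funext y; rw [hw₀]
  rw [hw] at h1
  exact h1

end Summit.QuantumFields.YangMills.Cruxes.NT.MirrorHankel

end
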